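import Mathlib
import Summits.PneNP.PneNP.Theorems.KrwChromaticSteeringStrongCompositionLrbClassDefs

/-!
# Route KrwChromaticSteering, crux `StrongComposition` (stmt-PneNP-18538) — objects of the line `lrx-gluing`:
# the rung `StrongCompositionLRX`, the statement `LRXQuantitative`, the type-A step statements, padded and decoupling trees

Definitions file (no theorem of substance) for the crux line `lrx-gluing` (skeleton
`Summits/PneNP/PneNP/Cruxes/StrongComposition/Lines/lrx_gluing.lean`, lead prover g2; registered sha 09c5aae6…, crux write
79c0db01e2dc; CLOSED v2, crux write dae79b7d2e87).  The line proves the RUNG `StrongCompositionLRX`: the crux C1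
`Summit.PneNP.PneNP.Theses.KrwChromaticSteering.StrongComposition` (Meir's strong composition with `γ = 1`) with its loss relaxed by
the CROSSING BUDGET `t`, for protocols of the class `LRX_t` (`KrwLrb.LRXDisciplined g t`, landed in
`KrwChromaticSteeringStrongCompositionLrbClassDefs.lean`: node tests = label ∨ affine ∨ single-row tests, rows typed online with
loads; an affine test may pass through rows already cut by single-row tests — «type-A» nodes —, its crossing weight being the number
of such combinatorial rows it meets, total weight `≤ t` on every root–leaf path).  `LRX_0 = LRB`, so at `t = 0` the rung is the
PROVED rung C1|LRB (`KrwLrb.strongCompositionLRB`, `…LrbRung.lean`), below which sits the PROVED rung C1|LRAD.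

Crux workfiles are not importable modules, so the line's objects are carried here with declaration bodies VERBATIM their namesakes
in `…Cruxes.StrongComposition.LrxGluing` (the two statements of §1 are themselves verbatim `P4g20X.StrongCompositionLRX` /
`P4g20X.LRXQuantitative` of the planner's sketch `Cruxes/StrongComposition/NextRungP4g20.lean`), over the IMPORTED vocabulary of
`…Theorems.KrwLrad` / `…Theorems.KrwLrb` — nothing is re-declared:

* §1 the rung `StrongCompositionLRX` and the quantitative adversary statement `LRXQuantitative` (proved in
  `KrwChromaticSteeringStrongCompositionLrxQuantitative.lean`, `C = 1`);
* §2 the two REGISTERED STUB STATEMENTS of the line, `CrossingStepAlice` / `CrossingStepBob` — the type-A step: at an affine test of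
  crossing weight `w`, the glued LRAD invariant `KrwLrad.InvAt` of the two subtrees (at the projection of the retyped typing) gives
  the invariant of every tree playing like the node and at least `w` deeper («one unit of potential per combinatorial row crossed»,
  memo `Cruxes/StrongComposition/LensBarrierP4g20.md` §3) — proved in `KrwChromaticSteeringStrongCompositionLrxDecoupling.lean`;
* §3 the two auxiliary objects of the proof: PADDED trees `pad t N` (`t` dummy rounds on top of `N`: the invariant with potential
  shifted by `t` is the invariant on the padded tree) and the DECOUPLING TREES `decoupleA` / `decoupleB` of a type-A node (single-row
  parity tests on the crossed rows, then the affine test on the stripped support `strip`, constant corrected per branch), with the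
  listed crossed rows `combRows`.

Honest framing: a CLASS-RESTRICTED, budget-relaxed form of Meir's open problem (strong composition with `γ = 1`, [Meir2023] =
O. Meir, *Toward better depth lower bounds: a KRW-like theorem for strong composition*, FOCS 2023 / arXiv:2306.00615); the `t`-free
bound on LRA and C1 itself (all protocols) stay open; nothing in this file bears on P vs NP.
-/

set_option linter.dupNamespace false -- `Summit.PneNP.PneNP.…`: summit = sub-problem name (D-0017 single-conjunct layout)
set_option autoImplicit false

namespace Summit.PneNP.PneNP.Theorems.KrwLrx

open Literature.Computability.Complexity
open Summit.PneNP.PneNP.Theorems.KrwLrad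
open Summit.PneNP.PneNP.Theorems.KrwLrb

universe u

/-! ## §1  The rung and the load-bearing statement -/

/-- **The rung C1|LRX**: the crux `StrongComposition` (`g` existential, loss `O(log mn)`) with the loss relaxed by the crossing
budget `t`, for every `LRX_t` protocol.  VERBATIM the skeleton's registered target `LrxGluing.StrongCompositionLRX`
(= `P4g20X.StrongCompositionLRX`). -/
def StrongCompositionLRX : Prop :=
  ∃ c : ℕ, ∀ m n : ℕ, 1 ≤ n → ∀ f : (Fin m → Bool) → Bool, (∃ a b, f a ≠ f b) →
    ∃ g : (Fin n → Bool) → Bool, ∀ (t : ℕ) (P : KWTree (Fin m × Fin n)),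
      LRXDisciplined g t P → P.SolvesStrong f g →
      ∃ Q : KWTree (Fin m), Q.Solves f ∧ Q.depth + n ≤ P.depth + c * (Nat.log 2 (m * n) + 1) + t

/-- **`LRXQuantitative`**: for a non-constant outer `f` whose KW rectangle is `ℓ`-hard and an inner `g` that is `r`-affine-generic
and subspace-hard with budget `q ≥ 1`, `q + r + 1 ≤ n`, every `LRX_t` protocol for the strong composition game `KW_f ⊛ KW_g` has
depth `≥ ℓ + (q − 1) − C − t` for an absolute constant `C`.  VERBATIM the skeleton's `LrxGluing.LRXQuantitative`
(= `P4g20X.LRXQuantitative`); proved with `C = 1` in `…LrxQuantitative.lean`. -/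
def LRXQuantitative : Prop :=
  ∃ C : ℕ, ∀ (m n q r ℓ t : ℕ) (f : (Fin m → Bool) → Bool) (g : (Fin n → Bool) → Bool),
    (∃ a b, f a = true ∧ f b = false) →
    AffGeneric g r → q + r + 1 ≤ n → SubspaceHard g q → 1 ≤ q →
    Hard (f ⁻¹' {true}) (f ⁻¹' {false}) ℓ →
    ∀ P : KWTree (Fin m × Fin n), LRXDisciplined g t P → P.SolvesStrong f g →
      ℓ + (q - 1) ≤ P.depth + C + t

/-! ## §2  The two registered stub statements: the type-A step -/

/-- **Stub statement A — the type-A step, Alice node.**  For an Alice affine test `s = c ⊕ parityOn U` at the LRX typing `τ`: if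
both subtrees satisfy the glued LRAD invariant `KrwLrad.InvAt` at the projection of the retyped typing `retagX U τ`, then every tree
`N` with the node's play function and depth `≥ depth (alice s P Q) + affWeight U τ` satisfies `InvAt` at the projection of `τ`.
VERBATIM the skeleton's `LrxGluing.CrossingStepAlice` (the registered signature of `stub_crossingAlice`). -/
def CrossingStepAlice : Prop :=
  ∀ (m n q : ℕ) (g : (Fin n → Bool) → Bool), PerRowLU g m q → ∀ (i₀ : Fin m) (j₀ : Fin n) (τ : Fin m → RowTypeX)
    (s : (Fin m × Fin n → Bool) → Bool) (P Q N : KWTree (Fin m × Fin n)) (U : Finset (Fin m × Fin n)) (c : Bool),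
    (∀ X, s X = Bool.xor c (parityOn U X)) →
    InvAt g q (fun i => (retagX U τ i).proj) P → InvAt g q (fun i => (retagX U τ i).proj) Q →
    (∀ X Y, N.run X Y = (KWTree.alice s P Q).run X Y) →
    (KWTree.alice s P Q).depth + affWeight U τ ≤ N.depth →
    InvAt g q (fun i => (τ i).proj) N

/-- **Stub statement B — the type-A step, Bob node** (mirror image).  VERBATIM the skeleton's `LrxGluing.CrossingStepBob` (the
registered signature of `stub_crossingBob`). -/
def CrossingStepBob : Prop :=
  ∀ (m n q : ℕ) (g : (Fin n → Bool) → Bool), PerRowLU g m q → ∀ (i₀ : Fin m) (j₀ : Fin n) (τ : Fin m → RowTypeX)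
    (s : (Fin m × Fin n → Bool) → Bool) (P Q N : KWTree (Fin m × Fin n)) (U : Finset (Fin m × Fin n)) (c : Bool),
    (∀ Y, s Y = Bool.xor c (parityOn U Y)) →
    InvAt g q (fun i => (retagX U τ i).proj) P → InvAt g q (fun i => (retagX U τ i).proj) Q →
    (∀ X Y, N.run X Y = (KWTree.bob s P Q).run X Y) →
    (KWTree.bob s P Q).depth + affWeight U τ ≤ N.depth →
    InvAt g q (fun i => (τ i).proj) N

/-! ## §3  Auxiliary objects of the proof: padded trees, stripped supports, decoupling trees, listed crossed rows -/

section Aux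

variable {m n : ℕ}

/-- `pad t N`: `t` dummy Alice nodes (constant bit, both subtrees `N`) on top of `N` — same play, depth `+ t`; the glued invariant
on `pad t N` is the invariant of `N` with the potential shifted by `t`.  VERBATIM the skeleton's `LrxGluing.pad`. -/
def pad {ι : Type u} : ℕ → KWTree ι → KWTree ι
  | 0, N => N
  | t + 1, N => KWTree.alice (fun _ => false) (pad t N) (pad t N)

/-- Strip the rows of a list from a support, head row first (the supports met along a decoupling tree).  VERBATIM the skeleton's
`LrxGluing.strip`. -/
def strip : List (Fin m) → Finset (Fin m × Fin n) → Finset (Fin m × Fin n)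
  | [], U => U
  | i :: rows, U => strip rows (offRow U i)

/-- **Alice's decoupling tree** of the affine test `X ↦ c ⊕ parityOn U X` along the rows `rows`: single-row PARITY tests on the
listed rows (`X ↦ ⊕_{(i,j) ∈ U} X_{ij}` for the head row `i`), then — on each branch — the affine test on the stripped support with
the constant corrected by the parities answered on the branch; subtrees `P` (bit `false`) and `Q` (bit `true`) at the bottom.
VERBATIM the skeleton's `LrxGluing.decoupleA`. -/
def decoupleA (P Q : KWTree (Fin m × Fin n)) :
    List (Fin m) → Finset (Fin m × Fin n) → Bool → KWTree (Fin m × Fin n)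
  | [], U, c => KWTree.alice (fun X => Bool.xor c (parityOn U X)) P Q
  | i :: rows, U, c => KWTree.alice (fun X => rowParity (rowSupp U i) (row X i))
      (decoupleA P Q rows (offRow U i) c) (decoupleA P Q rows (offRow U i) (!c))

/-- **Bob's decoupling tree** (mirror image: the tests read Bob's matrix).  VERBATIM the skeleton's `LrxGluing.decoupleB`. -/
def decoupleB (P Q : KWTree (Fin m × Fin n)) :
    List (Fin m) → Finset (Fin m × Fin n) → Bool → KWTree (Fin m × Fin n)
  | [], U, c => KWTree.bob (fun Y => Bool.xor c (parityOn U Y)) P Q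
  | i :: rows, U, c => KWTree.bob (fun Y => rowParity (rowSupp U i) (row Y i))
      (decoupleB P Q rows (offRow U i) c) (decoupleB P Q rows (offRow U i) (!c))

/-- The combinatorial rows an affine support meets at an LRX typing, listed (its length is the crossing weight `affWeight U τ`).
VERBATIM the skeleton's `LrxGluing.combRows`. -/
noncomputable def combRows (U : Finset (Fin m × Fin n)) (τ : Fin m → RowTypeX) : List (Fin m) :=
  ((eqRows U).filter fun i => τ i = RowTypeX.combinatorial).toList

end Aux

end Summit.PneNP.PneNP.Theorems.KrwLrx
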